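import Summits.HubbardSuperconductivity.HubbardSuperconductivity.Theorems.AnisotropyChordTransferFibre3RowCChi
import Summits.HubbardSuperconductivity.HubbardSuperconductivity.Theorems.AnisotropyChordTransferFibre3NC0Row
import Summits.HubbardSuperconductivity.HubbardSuperconductivity.Theorems.AnisotropyChordTransferFibre3RowCPsi
import Summits.HubbardSuperconductivity.HubbardSuperconductivity.Theorems.AnisotropyChordTransferFibre3RowCGradSup

/-!
# Route `AnisotropyChord` / H0 rotor rung, row C (KT-2b) of the LEVEL-2 certificate: the `‖C0′‖²` input in NORMALISED CLOSED FORM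

PartN41-C §5: `Nhi ≥ ‖C0′‖²` is `NC0Row` with `Ψ⁺ := PsiSemiClosed`, `δ := GradSupBound`, `M := f_max`, the six window
configurations `Σ_{b ∈ shellWin} C0(x̂,b)²` and the bulk `(17f_nn²δ² + 8ξ²M² + 16ζ²M²)·τ̄`.  THIS FILE writes it as an explicit
function ★ `NhiN t ν a x₄ k₁₁ k₂₀ zw` of the cell variables `t = θ², ν, a`, the B1 bracket variable `x₄ = θ⁴S₂`, the two
second-shell window values `k₁₁ = a_λ(1,1)`, `k₂₀ = a_λ(2,0)` (enclosed ∀ `L ≥ 128` by `ManifoldA.second_shell_window`) and any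
upper bound `zw` of the window sum (`…RowCShellWin`), with no negative power of `t`, and proves for the ground profile at every
`L ≥ 128` (`0 ≤ Δ < 1`):  ★ `nC0p_le_NhiN`.
Ingredients: `nC0Row_holds`, `psiSemiClosed_holds` (clause 6), `lapNormNamed_holds` + `gapEquationS1_holds` (`‖T₀s‖²` closed:
`lapN = c_s²(1 − t/4π²)/4 + (c_s/2)νt(1 − a + at/4π²) + c_s²ν²x₄t/16π²`), `gradSupBound_holds` (`δ = η + 0.001c_s`),
`RowC.abs_f_le_MN`, `RowC.Rbar_eq_RbN` (`τ̄ = tauN`), `ManifoldA.axis_window_closed` (`f(r) = a + c_s a_λ(r)`,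
`a_λ(x̂) = k10N t a`).
Prover seat `hubbard-h0-rotor-p1` g28 (route lead); helper for piece A = stmt-HubbardSuperconductivity-23918 of rung 19089
(`--supports`, helper class).  WHAT THIS IS NOT: nothing here proves superconductivity in the Hubbard model; a closed-form
majorant of one input of ONE row of ONE conditional reduction; the rotor TARGET as originally worded stays FALSE (g15 verdict).
Tree imports only; no sorry, no new axioms.
-/

set_option linter.dupNamespace false
set_option autoImplicit false

noncomputable section

open scoped BigOperators

namespace Summit.HubbardSuperconductivity.HubbardSuperconductivity.Theorems.AnisotropyChord.Transfer.Fibre3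

namespace RowC

variable (L : ℕ) [NeZero L]

/-! ## The normalised closed forms -/

/-- `a_λ(x̂) = (1 − t/4π² + (1 − a + at/4π²)·t/(4π² + at))/4` (`= (1 − 1/V + λ₂G̃(0))/4`). -/
def k10N (t a : ℝ) : ℝ :=
  (1 - t / (4 * Real.pi ^ 2) + (1 - a + a * t / (4 * Real.pi ^ 2)) * t / (4 * Real.pi ^ 2 + a * t)) / 4

/-- `ξ = c_s(a_λ(2,0) − a_λ(1,0))`. -/
def xiN (t ν a k20 : ℝ) : ℝ := csN t ν a * (k20 - k10N t a)

/-- `ζ = c_s(a_λ(1,1) − a_λ(1,0))`. -/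
def zeN (t ν a k11 : ℝ) : ℝ := csN t ν a * (k11 - k10N t a)

/-- `κ_w = 2η² + ξ² + 2ζ²`. -/
def kapN (t ν a k11 k20 : ℝ) : ℝ := 2 * etaN ν ^ 2 + xiN t ν a k20 ^ 2 + 2 * zeN t ν a k11 ^ 2

/-- `crossW = η² − 2ηζ + 2ξζ`. -/
def crN (t ν a k11 k20 : ℝ) : ℝ := etaN ν ^ 2 - 2 * etaN ν * zeN t ν a k11 + 2 * xiN t ν a k20 * zeN t ν a k11

/-- `‖T₀s‖² = c_s²(1 − t/4π²)/4 + (c_s/2)νt(1 − a + at/4π²) + c_s²ν²x₄t/16π²`. -/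
def lapN (t ν a x4 : ℝ) : ℝ :=
  csN t ν a ^ 2 * (1 - t / (4 * Real.pi ^ 2)) / 4 + csN t ν a / 2 * (ν * t) * (1 - a + a * t / (4 * Real.pi ^ 2))
    + csN t ν a ^ 2 * ν ^ 2 * x4 * t / (16 * Real.pi ^ 2)

/-- `δ = η + 0.001c_s` (`GradSupBound`). -/
def delN (t ν a : ℝ) : ℝ := etaN ν + 0.001 * csN t ν a

/-- `Ψ⁺ = 8(τ̄ − κ_w)² + 8·max(crossW, ‖T₀s‖²/4 − crossW)²`. -/
def PsiN (t ν a x4 k11 k20 : ℝ) : ℝ :=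
  8 * (tauN t ν a x4 - kapN t ν a k11 k20) ^ 2
    + 8 * (max (crN t ν a k11 k20) (lapN t ν a x4 / 4 - crN t ν a k11 k20)) ^ 2

/-- the bulk `(17f_nn²δ² + 8ξ²M² + 16ζ²M²)·τ̄`. -/
def bulkN (t ν a x4 k11 k20 : ℝ) : ℝ :=
  (17 * fnnN ν a ^ 2 * delN t ν a ^ 2 + 8 * xiN t ν a k20 ^ 2 * MN t ν a ^ 2 + 16 * zeN t ν a k11 ^ 2 * MN t ν a ^ 2)
    * tauN t ν a x4

/-- ★ `Nhi`, normalised: `(9/4)M²Ψ⁺ + 12(zw + bulk)`. -/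
def NhiN (t ν a x4 k11 k20 zw : ℝ) : ℝ := 9 / 4 * MN t ν a ^ 2 * PsiN t ν a x4 k11 k20 + 12 * (zw + bulkN t ν a x4 k11 k20)

/-! ## Two window sites are off the origin -/

omit [NeZero L] in
/-- `2x̂ ≠ 0` (`L ≥ 3`). [folklore] -/
theorem two_ex_ne_zero (hL : 3 ≤ L) : ex L + ex L ≠ 0 := by
  intro h
  have h1 : ((2 : ℕ) : ZMod L) = 0 := by
    have := congrArg Prod.fst h
    simp only [ex, Prod.fst_add, Prod.fst_zero] at this
    have e : ((2 : ℕ) : ZMod L) = 1 + 1 := by norm_num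
    rw [e]; exact this
  rw [ZMod.natCast_eq_zero_iff] at h1
  have := Nat.le_of_dvd (by norm_num) h1
  omega

omit [NeZero L] in
/-- `x̂ + ŷ ≠ 0` (`L ≥ 2`). [folklore] -/
theorem ex_add_ey_ne_zero (hL : 2 ≤ L) : ex L + ey L ≠ 0 := by
  intro h
  have h2 := congrArg Prod.snd h
  simp only [ex, ey, Prod.snd_add, Prod.snd_zero, zero_add] at h2
  apply K1_ne_zero L hL
  unfold K1
  ext <;> simp [h2]

/-! ## The true quantities in the cell variables -/

section ingredients
variable {L}
variable (hL : 128 ≤ L) {Δ lam2 : ℝ} {f : Tor L → ℝ} (hΔ0 : 0 ≤ Δ) (hΔ1 : Δ < 1) (hf : IsGroundTwoMagnon L Δ lam2 f)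
include hL hΔ0 hΔ1 hf

/-- `τ̄ = ‖∇ₓs‖² = tauN`. [folklore] -/
theorem gradNormSq_eq_tauN :
    gradNormSq L Δ f = tauN ((2 * Real.pi / L) ^ 2) (lam2 / (2 * Real.pi / L) ^ 2) (Δ * f (K1 L))
      (((2 * Real.pi / L) ^ 2) ^ 2 * S2n L lam2) := by
  have hL3 : 3 ≤ L := by omega
  have h := Rbar_eq_RbN hL hΔ0 hΔ1 hf
  rw [rbarClosed_holds L Δ lam2 f hL3 hf] at h
  obtain ⟨hη, _, _, _⟩ := dict_N hL hΔ0 hΔ1 hf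
  unfold RbN at h
  rw [hη] at h
  linarith

/-- `a_λ(x̂) = k10N t a`. [folklore] -/
theorem aKer_ex_eq_k10N : aKer L lam2 (ex L) = k10N ((2 * Real.pi / L) ^ 2) (Δ * f (K1 L)) := by
  have hL5 : 5 ≤ L := by omega
  have hL0 : (0 : ℝ) < L := by exact_mod_cast (show 0 < L by omega)
  have hπ := Real.pi_pos
  obtain ⟨_, _, _, hV⟩ := dict_N hL hΔ0 hΔ1 hf
  obtain ⟨hax, _⟩ := ManifoldA.axis_window_closed L hL5 hΔ0 hΔ1 hf
  rw [hax (ex L) (ex_mem_nnList L)]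
  unfold k10N
  have ha0 : 0 ≤ Δ * f (K1 L) := mul_nonneg hΔ0 hf.1.2.2.1.le
  have hVpos : (0 : ℝ) < (L : ℝ) ^ 2 := by positivity
  have ht0 : 0 < (2 * Real.pi / L) ^ 2 := by positivity
  rw [hV]
  field_simp

/-- the window values through `a_λ`: `ξ = xiN`, `ζ = zeN`. [folklore] -/
theorem xiW_zetaW_eq :
    xiW L f = xiN ((2 * Real.pi / L) ^ 2) (lam2 / (2 * Real.pi / L) ^ 2) (Δ * f (K1 L)) (aKer L lam2 (ex L + ex L)) ∧
    zetaW L f = zeN ((2 * Real.pi / L) ^ 2) (lam2 / (2 * Real.pi / L) ^ 2) (Δ * f (K1 L)) (aKer L lam2 (ex L + ey L)) := by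
  have hL5 : 5 ≤ L := by omega
  have hL3 : 3 ≤ L := by omega
  obtain ⟨_, hcs, _, _⟩ := dict_N hL hΔ0 hΔ1 hf
  obtain ⟨_, hwin⟩ := ManifoldA.axis_window_closed L hL5 hΔ0 hΔ1 hf
  have hk10 := aKer_ex_eq_k10N hL hΔ0 hΔ1 hf
  have hx0 : ex L ≠ 0 := by rw [← K1_eq_ex]; exact K1_ne_zero L (by omega)
  have hxx0 : ex L + ex L ≠ 0 := two_ex_ne_zero L hL3
  have hxy0 : ex L + ey L ≠ 0 := ex_add_ey_ne_zero L (by omega)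
  have e1 := hwin (ex L) hx0
  have e2 := hwin (ex L + ex L) hxx0
  have e3 := hwin (ex L + ey L) hxy0
  unfold xiW zetaW xiN zeN
  rw [← hcs, ← hk10]
  constructor <;> linarith

/-- `‖T₀s‖² = lapN`. [folklore] -/
theorem lapNormSq_eq_lapN :
    lapNormSq L Δ f = lapN ((2 * Real.pi / L) ^ 2) (lam2 / (2 * Real.pi / L) ^ 2) (Δ * f (K1 L))
      (((2 * Real.pi / L) ^ 2) ^ 2 * S2n L lam2) := by
  classical
  have hL5 : 5 ≤ L := by omega
  have hL3 : 3 ≤ L := by omega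
  have hL0 : (0 : ℝ) < L := by exact_mod_cast (show 0 < L by omega)
  have hπ := Real.pi_pos
  have ht0 : 0 < (2 * Real.pi / L) ^ 2 := by positivity
  obtain ⟨_, hcs, _, hV⟩ := dict_N hL hΔ0 hΔ1 hf
  have hlam0 : 0 < lam2 := lam2_pos L hL3 hΔ1 hf.1
  have hlap := lapNormNamed_holds L Δ lam2 f hL5 hΔ0 hΔ1 hf
  have hgap := gapEquationS1_holds L hL5 hΔ0 hΔ1 lam2 f hf hlam0
  unfold aPar at hgap
  -- expand the sum over `k ≠ 0`
  have hg0 : gres L lam2 0 = 0 := by unfold gres; simp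
  have hS1 : ∑ k ∈ (Finset.univ : Finset (Tor L)).erase 0, gres L lam2 k = S1n L lam2 := by
    rw [S1n_eq, ← Finset.sum_erase_add _ _ (Finset.mem_univ (0 : Tor L)), hg0, add_zero]
  have hS2 : ∑ k ∈ (Finset.univ : Finset (Tor L)).erase 0, gres L lam2 k ^ 2 = S2n L lam2 := by
    rw [S2n_eq, ← Finset.sum_erase_add _ _ (Finset.mem_univ (0 : Tor L)), hg0]; ring
  have hcard : (((Finset.univ : Finset (Tor L)).erase 0).card : ℝ) = (L : ℝ) ^ 2 - 1 := by
    rw [Finset.card_erase_of_mem (Finset.mem_univ _), Finset.card_univ]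
    have : Fintype.card (Tor L) = L * L := by simp [ZMod.card]
    rw [this]
    have hL1 : 1 ≤ L * L := Nat.one_le_iff_ne_zero.mpr (by positivity)
    push_cast [Nat.cast_sub hL1]
    ring
  have hsum : ∑ k ∈ (Finset.univ : Finset (Tor L)).erase 0, (1 + lam2 * gres L lam2 k) ^ 2
      = ((L : ℝ) ^ 2 - 1) + 2 * lam2 * S1n L lam2 + lam2 ^ 2 * S2n L lam2 := by
    have e : ∀ k : Tor L, (1 + lam2 * gres L lam2 k) ^ 2 = 1 + 2 * lam2 * gres L lam2 k + lam2 ^ 2 * gres L lam2 k ^ 2 := by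
      intro k; ring
    simp only [e, Finset.sum_add_distrib, Finset.sum_const, nsmul_eq_mul, mul_one, ← Finset.mul_sum, hS1, hS2, hcard]
  rw [hlap, hsum]
  -- `c_s S₁ = V − a(V − 1)`, `c_s > 0`
  have hcpos : 0 < cS L Δ lam2 f := by
    unfold cS
    have hf1 : 0 < f (K1 L) := hf.1.2.2.1
    have : 0 < 4 * (1 - Δ) + Δ * lam2 := by nlinarith [mul_nonneg hΔ0 hlam0.le]
    exact mul_pos hf1 this
  have hS1v : S1n L lam2 = ((L : ℝ) ^ 2 - Δ * f (K1 L) * ((L : ℝ) ^ 2 - 1)) / cS L Δ lam2 f := by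
    rw [eq_div_iff hcpos.ne', mul_comm]; exact hgap
  rw [hS1v]
  unfold lapN
  rw [← hcs]
  set c := cS L Δ lam2 f with hcdef
  have hc0 : c ≠ 0 := hcpos.ne'
  rw [hV]
  field_simp
  ring

end ingredients

/-! ## The bound -/

/-- ★★ **THE `‖C0′‖²` INPUT IN NORMALISED CLOSED FORM** (`L ≥ 128`, ground profile, `0 ≤ Δ < 1`, `Σ_{shellWin} C0² ≤ zw`). [folklore] -/
theorem nC0p_le_NhiN (hL : 128 ≤ L) {Δ lam2 : ℝ} {f : Tor L → ℝ} (hΔ0 : 0 ≤ Δ) (hΔ1 : Δ < 1)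
    (hf : IsGroundTwoMagnon L Δ lam2 f) (zw : ℝ)
    (hzw : (∑ b ∈ shellWin L, C0fn L Δ lam2 f (ex L, b) ^ 2) ≤ zw) :
    nC0p L Δ f ≤ NhiN ((2 * Real.pi / L) ^ 2) (lam2 / (2 * Real.pi / L) ^ 2) (Δ * f (K1 L))
      (((2 * Real.pi / L) ^ 2) ^ 2 * S2n L lam2) (aKer L lam2 (ex L + ey L)) (aKer L lam2 (ex L + ex L)) zw := by
  have hL5 : 5 ≤ L := by omega
  have hL3 : 3 ≤ L := by omega
  have hL2 : 2 ≤ L := by omega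
  have hL0 : (0 : ℝ) < L := by exact_mod_cast (show 0 < L by omega)
  have hπ := Real.pi_pos
  set t : ℝ := (2 * Real.pi / L) ^ 2 with ht
  have ht0 : 0 < t := by positivity
  set ν : ℝ := lam2 / t with hν
  set a : ℝ := Δ * f (K1 L) with ha
  set x4 : ℝ := t ^ 2 * S2n L lam2 with hx4
  set k11 : ℝ := aKer L lam2 (ex L + ey L) with hk11
  set k20 : ℝ := aKer L lam2 (ex L + ex L) with hk20
  obtain ⟨hη, hcs, hfnn, hV⟩ := dict_N hL hΔ0 hΔ1 hf
  rw [← ht, ← hν] at hη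
  rw [← ht, ← hν, ← ha] at hcs hfnn
  have hνle : lam2 ≤ 0.0513 * (2 * Real.pi / L) ^ 2 := by
    have h := ManifoldA.nu_ceiling L hL hΔ0 hf
    rw [← ht] at h ⊢
    have : 0.031 * t ≤ 0.0513 * t := by nlinarith [ht0.le]
    linarith
  have hswap : ∀ r : Tor L, f (r.2, r.1) = f r := ground_swap L hL2 hf
  have hmirror : ∀ r : Tor L, f (-r.1, r.2) = f r := ground_mirror L hL2 hf
  have hM := abs_f_le_MN hL hΔ0 hΔ1 hf
  rw [← ht, ← hν, ← ha] at hM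
  -- `δ = η + 0.001 c_s`
  have hδ : ∀ e ∈ nnList L, ∀ b : Tor L, b ≠ 0 → b - e ≠ 0 → |Dgrad L f e b| ≤ delN t ν a := by
    intro e he b hb hbe
    have h := gradSupBound_holds L hL Δ lam2 f hΔ0 hΔ1 hf hνle e he b hb hbe
    unfold delN; rw [← hη, ← hcs]; exact h
  have hδ0 : 0 ≤ delN t ν a := by
    have := hδ (ex L) (ex_mem_nnList L) (ex L + ex L) (two_ex_ne_zero L hL3) (by rw [add_sub_cancel_right, ← K1_eq_ex]; exact K1_ne_zero L hL2)
    exact le_trans (abs_nonneg _) this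
  -- `NC0Row`
  have hrow := nC0Row_holds L hL3 Δ lam2 (MN t ν a) (delN t ν a) f hf hswap hmirror hM hδ hδ0
  -- `Ψ` semi-closed
  obtain ⟨_, _, _, _, _, hpsi⟩ := psiSemiClosed_holds L Δ lam2 f hL5 hΔ0 hΔ1 hf
  -- substitutions
  have hτ := gradNormSq_eq_tauN hL hΔ0 hΔ1 hf
  obtain ⟨hxi, hze⟩ := xiW_zetaW_eq hL hΔ0 hΔ1 hf
  have hlap := lapNormSq_eq_lapN hL hΔ0 hΔ1 hf
  rw [← ht, ← hν, ← ha, ← hx4] at hτ hlap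
  rw [← ht, ← hν, ← ha, ← hk20] at hxi
  rw [← ht, ← hν, ← ha, ← hk11] at hze
  have hkap : kapW L lam2 f = kapN t ν a k11 k20 := by unfold kapW kapN; rw [hη, hxi, hze]
  have hcr : crossW L lam2 f = crN t ν a k11 k20 := by unfold crossW crN; rw [hη, hxi, hze]
  have hPsi : PsiSum L Δ f ≤ PsiN t ν a x4 k11 k20 := by
    unfold PsiN; rw [← hτ, ← hkap, ← hcr, ← hlap]; exact hpsi
  have hM2 : 0 ≤ 9 / 4 * MN t ν a ^ 2 := by positivity
  have hbulk : (17 * f (ex L) ^ 2 * delN t ν a ^ 2 + 8 * xiW L f ^ 2 * MN t ν a ^ 2 + 16 * zetaW L f ^ 2 * MN t ν a ^ 2)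
      * gradNormSq L Δ f = bulkN t ν a x4 k11 k20 := by
    unfold bulkN; rw [← K1_eq_ex, hfnn, hxi, hze, hτ]
  unfold NhiN
  rw [← hbulk]
  have := mul_le_mul_of_nonneg_left hPsi hM2
  linarith [hrow]

end RowC

end Summit.HubbardSuperconductivity.HubbardSuperconductivity.Theorems.AnisotropyChord.Transfer.Fibre3

end
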